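import Literature.NumberTheory.Automorphic.UnitaryGroupIsotropicLineElements     -- ★ A-p10: `hermForm`, `hermRow`, `mem_unitaryGroupOfForm_iff_hermForm`
import Mathlib.LinearAlgebra.Eigenspace.Zero
import Mathlib.LinearAlgebra.Charpoly.ToMatrix
import Mathlib.LinearAlgebra.Matrix.Charpoly.Basic
import Mathlib.RingTheory.Polynomial.Basic
import HarnessLib

/-!
# A unitary operator's eigenvector for a SIMPLE eigenvalue `λ` with `λ·σ(λ) = 1` is ANISOTROPIC (non-degenerate hermitian form)
# — the anisotropy GUARD of the «compact mod M» argument (N6nsGerm (S1), file 3a)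

Topic `NumberTheory/Automorphic`; namespace `Literature.NumberTheory.Automorphic.UnitaryGroup`. KERNEL ONLY: theorems, no definition, no named fact, no instance,
no notation, no `sorry`.  Cell `pub/hodgecm-mathlib` (LEAD F0P3a-plan (g9) T8-38 (1) ∕ T8-65 (2); road «N6nsGerm» (S1), binder (B4-top)(3); census
`F0/P3a/A-p16/g26/CENSUS-N6nsGerm-S1.A-p16g26.md` §5 (F-eig)'s GUARD).

THE MATHEMATICS.  `h` a `σ`-hermitian form with `det H ≠ 0`, `ω ∈ U(σ, H)`, `ω w = λ w`, `λ σ(λ) = 1`.  Unitarity gives `h(w, ω y) = λ h(w, y)`, i.e.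
**`h(w, (ω − λ) y) = 0` for all `y`** (§1).  If moreover `λ` is a SIMPLE root of `χ_ω` — `χ_ω = (X − λ)·q`, `q(λ) ≠ 0` — then Bézout `a(X − λ) + b q = 1` splits every `v`
as `(ω − λ) a(ω) v + q(ω) b(ω) v` with `q(ω) b(ω) v ∈ ker(ω − λ)` (Cayley–Hamilton), and `ker(ω − λ) = K w` (geometric ≤ algebraic multiplicity `= 1`, Mathlib
`LinearMap.finrank_eigenspace_le`); so `h(w, w) = 0` would force `h(w, ·) = 0`, i.e. `w = 0` by non-degeneracy (§2 **`hermForm_self_ne_zero_of_eigen_simple`**).  This is why, near a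
`(G,H)`-regular semisimple point, the windowed eigenvectors `x v₁` of the conjugates `x m x⁻¹` stay uniformly anisotropic (file 2's GUARD).

HONEST SCOPE.  Hermitian linear algebra over a field with involution.  HC_CM is proved only modulo the printed citations until rung 0 closes; this file discharges no printed
statement.

## References
* [Dieudonne1971GroupesClassiques] J. Dieudonné, *La géométrie des groupes classiques*, 3e éd. (1971), Chap. I §11, Chap. II §4 (eigenvectors of unitary operators; isotropy).
* [HarishChandra1970] Harish-Chandra (notes by G. van Dijk), *Harmonic Analysis on Reductive p-adic Groups*, LNM 162 (1970), Part II §5.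
-/

set_option autoImplicit false

open Polynomial Matrix

namespace Literature.NumberTheory.Automorphic.UnitaryGroup

variable {K : Type*} [Field K] (σ : K →+* K) {n : Type*} [Fintype n] [DecidableEq n] (H : Matrix n n K)

/-! ## §1 `h(w, (ω − λ) y) = 0` for an eigenvector `w` of a unitary `ω` with `λ σ(λ) = 1` -/

/-- **`h(w, ω y − λ y) = 0`**: for `ω ∈ U(σ, H)`, `ω w = λ w` and `λ σ(λ) = 1`, the form `h(w, ·)` kills `range (ω − λ)` (`h(w, ω y) = λ h(w, y)` by unitarity).
[cite: Dieudonne1971GroupesClassiques, Chap. II §4] -/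
theorem hermForm_eigen_sub_eq_zero {ω : GL n K} (hω : ω ∈ unitaryGroupOfForm σ H) {w : n → K} {l : K} (hw : (ω : Matrix n n K) *ᵥ w = l • w)
    (hl : l * σ l = 1) (y : n → K) : hermForm σ H w ((ω : Matrix n n K) *ᵥ y - l • y) = 0 := by
  have hu := (mem_unitaryGroupOfForm_iff_hermForm σ H ω).1 hω w y
  rw [hw, hermForm_smul_left_eq] at hu
  -- `σ l * h(w, ω y) = h(w, y)` ⇒ `h(w, ω y) = l * h(w, y)`
  have h1 : hermForm σ H w ((ω : Matrix n n K) *ᵥ y) = l * hermForm σ H w y := by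
    have := congrArg (fun t => l * t) hu
    simpa only [← mul_assoc, hl, one_mul] using this
  rw [hermForm_sub_right, hermForm_smul_right, h1, sub_self]

/-! ## §2 Simple unitary eigenvalues have anisotropic eigenvectors -/

/-- Non-degeneracy: `h(x, y) = 0` for all `y` forces `x = 0` (`det H ≠ 0`, `σ` injective). [cite: Dieudonne1971GroupesClassiques, Chap. I §11] -/
theorem eq_zero_of_forall_hermForm_eq_zero (hHd : H.det ≠ 0) {x : n → K} (hx : ∀ y, hermForm σ H x y = 0) : x = 0 := by
  have hrow : hermRow σ H x = 0 := by
    funext j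
    have h := hx (Pi.single j 1)
    rw [← hermRow_dotProduct, dotProduct_single_one] at h
    exact h
  have hinj := Matrix.vecMul_injective_iff_isUnit.2 ((Matrix.isUnit_iff_isUnit_det H).2 (Ne.isUnit hHd))
  have hzero : (⇑σ ∘ x : n → K) = 0 := by
    apply hinj
    show (⇑σ ∘ x) ᵥ* H = (0 : n → K) ᵥ* H
    rw [Matrix.zero_vecMul]
    exact hrow
  funext i
  have hi := congrFun hzero i
  simp only [Function.comp_apply, Pi.zero_apply, map_eq_zero] at hi
  exact hi

/-- **SIMPLE UNITARY EIGENVALUES HAVE ANISOTROPIC EIGENVECTORS.** `H` hermitian data with `det H ≠ 0`, `ω ∈ U(σ, H)`, `ω w = λ w`, `w ≠ 0`, `λ σ(λ) = 1`, and `λ` a SIMPLE root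
of `χ_ω`: `χ_ω = (X − λ)·q` with `q(λ) ≠ 0`.  Then `h(w, w) ≠ 0`. [cite: Dieudonne1971GroupesClassiques, Chap. II §4] [cite: HarishChandra1970, Part II §5] -/
theorem hermForm_self_ne_zero_of_eigen_simple (hHd : H.det ≠ 0) {ω : GL n K} (hω : ω ∈ unitaryGroupOfForm σ H) {w : n → K} (hw0 : w ≠ 0) {l : K}
    (hw : (ω : Matrix n n K) *ᵥ w = l • w) (hl : l * σ l = 1) {q : K[X]} (hχ : (ω : Matrix n n K).charpoly = (X - C l) * q) (hq : q.eval l ≠ 0) :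
    hermForm σ H w w ≠ 0 := by
  intro hww
  apply hw0
  apply eq_zero_of_forall_hermForm_eq_zero σ H hHd
  intro v
  -- Bézout: `a (X − λ) + b q = 1`
  have hcop : IsCoprime (X - C l) q := by
    refine (Polynomial.irreducible_X_sub_C l).coprime_iff_not_dvd.2 fun hdvd => hq ?_
    exact (Polynomial.dvd_iff_isRoot.1 hdvd)
  obtain ⟨a, b, hab⟩ := hcop
  set A : Matrix n n K := (ω : Matrix n n K) with hA
  -- `v = (ω − λ) (a(ω) v) + q(ω) (b(ω) v)`
  have hsplit : v = (A *ᵥ (aeval A a *ᵥ v) - l • (aeval A a *ᵥ v)) + aeval A q *ᵥ (aeval A b *ᵥ v) := by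
    have h1 : aeval A (a * (X - C l) + b * q) = 1 := by rw [hab, map_one]
    have h2 : aeval A (a * (X - C l) + b * q) = (A - algebraMap K (Matrix n n K) l) * aeval A a + aeval A q * aeval A b := by
      rw [mul_comm a, mul_comm b, map_add, map_mul, map_mul, map_sub, aeval_X, aeval_C]
    have h3 : ((A - algebraMap K (Matrix n n K) l) * aeval A a + aeval A q * aeval A b) *ᵥ v = v := by
      rw [← h2, h1, Matrix.one_mulVec]
    rw [Matrix.add_mulVec, ← Matrix.mulVec_mulVec, ← Matrix.mulVec_mulVec, Matrix.sub_mulVec, Algebra.algebraMap_eq_smul_one,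
      Matrix.smul_mulVec, Matrix.one_mulVec] at h3
    exact h3.symm
  -- the second summand lies in `ker (ω − λ)` (Cayley–Hamilton), hence in `K ∙ w` (simplicity)
  have hker : A *ᵥ (aeval A q *ᵥ (aeval A b *ᵥ v)) = l • (aeval A q *ᵥ (aeval A b *ᵥ v)) := by
    have hCH : (A - algebraMap K (Matrix n n K) l) * aeval A q = 0 := by
      have := Matrix.aeval_self_charpoly A
      rw [hχ, map_mul, map_sub, aeval_X, aeval_C] at this
      exact this
    have h1 : ((A - algebraMap K (Matrix n n K) l) * aeval A q) *ᵥ (aeval A b *ᵥ v) = 0 := by rw [hCH, Matrix.zero_mulVec]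
    rw [← Matrix.mulVec_mulVec, Matrix.sub_mulVec, Algebra.algebraMap_eq_smul_one, Matrix.smul_mulVec, Matrix.one_mulVec, sub_eq_zero] at h1
    exact h1
  -- `ker (ω − λ)` is the line `K ∙ w` (geometric ≤ algebraic multiplicity `= 1`)
  have hline : ∀ u : n → K, A *ᵥ u = l • u → ∃ c : K, u = c • w := by
    intro u hu
    let φ : Module.End K (n → K) := Matrix.toLin' A
    have hmem : ∀ z : n → K, A *ᵥ z = l • z → z ∈ φ.eigenspace l := fun z hz => by
      rw [Module.End.mem_eigenspace_iff, Matrix.toLin'_apply]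
      exact hz
    have hne : (X - C l) * q ≠ 0 := by rw [← hχ]; exact (Matrix.charpoly_monic A).ne_zero
    have hmult : φ.charpoly.rootMultiplicity l = 1 := by
      show (Matrix.toLin' A).charpoly.rootMultiplicity l = 1
      rw [Matrix.charpoly_toLin', hχ, Polynomial.rootMultiplicity_mul hne, Polynomial.rootMultiplicity_X_sub_C_self,
        Polynomial.rootMultiplicity_eq_zero (fun h => hq h), add_zero]
    have hle : Module.finrank K ↥(φ.eigenspace l) ≤ 1 := hmult ▸ LinearMap.finrank_eigenspace_le φ l
    have hwE : (⟨w, hmem w hw⟩ : ↥(φ.eigenspace l)) ≠ 0 := fun h => hw0 (congrArg Subtype.val h)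
    have hpos : 0 < Module.finrank K ↥(φ.eigenspace l) := Module.finrank_pos_iff_exists_ne_zero.2 ⟨_, hwE⟩
    have h1 : Module.finrank K ↥(φ.eigenspace l) = 1 := le_antisymm hle hpos
    obtain ⟨c, hc⟩ := (finrank_eq_one_iff_of_nonzero' _ hwE).1 h1 ⟨u, hmem u hu⟩
    exact ⟨c, by simpa using (congrArg Subtype.val hc).symm⟩
  -- conclude: `h(w, v) = h(w, (ω − λ)(a(ω) v)) + h(w, c • w) = 0 + c · h(w, w) = 0`
  obtain ⟨c, hc⟩ := hline _ hker
  rw [hsplit, hermForm_add_right, hermForm_eigen_sub_eq_zero σ H hω hw hl, zero_add, hc, hermForm_smul_right, hww, mul_zero]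

end Literature.NumberTheory.Automorphic.UnitaryGroup
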